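import Summits.Ventures.AbcSig.Rows.XTemplateCE
import Summits.Ventures.AbcSig.Rows.XTemplateEps4

/-!
# Venture AbcSig — ROW TEMPLATE `xⁿ + yⁿ = C z²`, `C = 2C'` EVEN, over a PART of the level `256·C'²` (cell module M10-ε₄)

HONEST FRAMING. Template file of a COMPUTATION cell (`pub-abcsig`); a CONDITIONAL theorem, no claim on ABC or any
summit. `xrow_template_evenC_part` below is `xrow_template_evenC` of `Rows/XTemplateCE.lean` with ONE change — the same
change that turns `xrow_template_odd` into `xrow_template_odd_part` (`Rows/XTemplateEps4.lean`): the computed level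
hypothesis `M.DataComplete (256·C'²) orbs` is replaced by the pair `M.ArisesInPart (256·C'²) P fam` (CITED existence
restriction, cell module M10-ε₄ = [DDT95, Thm. 3.15] applied to `ρ̄_{E,n} ⊗ χ₄⁻¹` at a prime `q ∥ C'`, `q ≡ 1 (mod 4)`;
statement AS PRINTED and hypothesis check in `Rows/XTemplateEps4.lean`) + `M.DataCompleteOn (256·C'²) P orbs` (COMPUTED:
the listed orbits are the whole part `P` — an installed ε₄ pair of `census/levels-eps4/`). Elementary reductions
verbatim from `TemplateCE.lean` / `XTemplateCE.lean` ([BS04, Lemma 2.1 case (ii), Lemma 3.2]: `C` even forces `xy` odd,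
`ord₂ C = 1`, level `2⁸·C'²`); final step `xno_solution_in_case_part`. Intended first use: `C = 58 = 2·29`, level
`215296 = 2⁸·29²`, ε₄@29-part (lead g16 RULING «C58 VIA EPS4-FOR», 2026-08-26T19:23:22Z), once that pair is installed and
its row is of record. p-lean g11, 2026-08-26.

References: [BS04] M. A. Bennett, C. M. Skinner, Canad. J. Math. 56 (2004) 23–54, §§2–5; [DDT95] H. Darmon, F. Diamond,
R. Taylor, Fermat's Last Theorem, CDM 1995, Thm. 3.15.
-/

namespace Summit.Ventures.AbcSig

/-- **Row template, `C = 2C'` even (`C'` odd squarefree), over a PART of the level `256·C'²`.** For a prime `n ≥ 7`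
with `n ∤ C'`, a part `P` of the newforms of level `256·C'²` with the CITED restriction `ArisesInPart` for the family
"`(1, 1, C)`, exponent `n`" and the COMPUTED completeness `DataCompleteOn` of the listed orbits on `P`, and per listed
orbit a kernel certificate, a cited family exclusion, or `ExcludesStd`: there is no primitive solution of
`xⁿ + yⁿ = C z²` with `xy ≠ ±1`. -/
theorem xrow_template_evenC_part (C C' : ℕ) (hC : C = 2 * C') (hsq : Squarefree C') (hodd : Odd C')
    (M : NewformModel) (hP : M.BS04Package) (n : ℕ) (hn : n.Prime) (h7 : 7 ≤ n) (hnC : ¬ n ∣ C')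
    {P : M.Form (256 * C' ^ 2) → Prop}
    (hpart : M.ArisesInPart (256 * C' ^ 2) P (fun S => S.A = 1 ∧ S.B = 1 ∧ S.C = C ∧ S.n = n))
    {orbs : List OrbitData} (hD : M.DataCompleteOn (256 * C' ^ 2) P orbs)
    (hS : ∀ o ∈ orbs, (∀ e ∈ o.coeffs, e.ell.Prime ∧ e.ell ≠ 2 ∧ ¬ e.ell ∣ 256 * C' ^ 2) ∧
      (o.Eliminated bs04Allowed n ∨ (M.Excludes (256 * C' ^ 2) o
        (fun S => S.A = 1 ∧ S.B = 1 ∧ S.C = C ∧ S.n = n) ∨ M.ExcludesStd (256 * C' ^ 2) o n)))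
    (a b c : ℤ) (h1 : a * b ≠ 1) (h2 : a * b ≠ -1) : ¬ IsPrimitiveSolution 1 1 C n a b c := by
  subst hC
  intro hsol
  have hC'pos : 0 < C' := hodd.pos
  have hab : ¬ 2 ∣ a * b := odd_ab_of_even_C (by omega) hsol
  have hord : OrdTwoEq (((2 * C' : ℕ) : ℤ)) 1 := by
    obtain ⟨k, hk⟩ := hodd
    refine ⟨⟨C', by push_cast; ring⟩, ?_⟩
    rintro ⟨m, hm⟩
    push_cast at hm
    omega
  have hcase : FreyCase.Holds .iiC 1 1 (2 * C') n a b c := ⟨hab, hord⟩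
  have hsqC : Squarefree (2 * C') := by
    rw [Nat.squarefree_mul]
    · exact ⟨Nat.prime_two.squarefree, hsq⟩
    · exact (Nat.coprime_two_left).mpr hodd
  have hndvd : ¬ n ∣ 1 * 1 * (2 * C') := by
    intro h
    rw [one_mul, one_mul] at h
    rcases (Nat.Prime.dvd_mul hn).mp h with h2 | hC
    · have := (Nat.prime_dvd_prime_iff_eq hn Nat.prime_two).mp h2
      omega
    · exact hnC hC
  have hfree : ∀ q : ℕ, q.Prime → ¬ q ^ n ∣ 1 ∧ ¬ q ^ n ∣ 1 := by
    intro q hq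
    have : ¬ q ^ n ∣ 1 := by
      intro h
      have h1 := Nat.dvd_one.mp h
      rw [Nat.pow_eq_one] at h1
      rcases h1 with h1 | h1
      · exact hq.one_lt.ne' h1
      · omega
    exact ⟨this, this⟩
  exact xno_solution_in_case_part M hP ⟨1, 1, 2 * C', n, a, b, c⟩ .iiC (256 * C' ^ 2) one_pos one_pos (by positivity)
    hsqC hn h7 hndvd hfree hsol h1 h2 hcase (bs04Level_one_one_twice C' n hsq hodd hnC)
    (fun S => S.A = 1 ∧ S.B = 1 ∧ S.C = 2 * C' ∧ S.n = n) ⟨rfl, rfl, rfl, rfl⟩ hpart hD hS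

end Summit.Ventures.AbcSig
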